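import Summits.CriticalPhenomena.CardyFormulaZ2.Theorems.CardyMagicRigidityNestingRigidityNeckFourArmInputsT
import HarnessLib

/-!
# Crux `NestingRigidity`, line `pinch-resampling` (v4), stub S11: recentring four-arm node events and nets on the inner layer of `𝕋`

Crux `Summit.CriticalPhenomena.CardyFormulaZ2.Theses.CardyMagicRigidity.NestingRigidity` (stmt-CriticalPhenomena-4835),
line `pinch-resampling` v4, stub S11 `stub_neckHookupCoarseT : NeckHookupCoarseT`.  The site-`𝕋` twin of
`…NeckZ2NodeCounting` (stub S12): the two lattice-specific COUNTING primitives of the multi-scale summation of the node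
events `TFourArmTwoClusters w r R` (`…NeckFourArmInputsT`) of the S11 road map (item 2: a hierarchy node "at scale `D`"
is positioned at resolution `D` on the inner layer, and its four-arm event must then depend on the coarse position only):

* §1 **Recentring** `NeckCoarse.tFourArmTwoClusters_of_near`: four arms in cluster form across
  `{r ≤ |· - w|_𝕋 ≤ R}` give four arms across every annulus `{r' ≤ |· - w'|_𝕋 ≤ R'}` inside it, `|w' - w|_𝕋 ≤ d`,
  `r + d + 1 ≤ r' ≤ R'`, `R' + d ≤ R` (crossing extraction from tight supports, `NeckCoarse.exists_crossing_of_pathIn`).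
* §2 **Nets on the inner layer** `NeckCoarse.exists_net_innerLayer`: at most `6 ((s+1)/D + 1)` sites of the hexagon
  `|· - x|_𝕋 = s + 1` within `𝕋`-distance `< D` of every inner-layer site of the collar `Λ_{2s}(x) ∖ Λ_s(x)` (the six
  sides `x + ρ^i (s+1, y)`, `-(s+1) ≤ y < 0`, of `exists_rot_side0`, sampled at the multiples of `D`).
* §3 The resulting union bound (`real_exists_tFourArm_innerLayer_le`, registered anchor): GIVEN the two-radius
  four-arm bound (I4T) `FourArmTwoClustersBoundT` with constants `C, ε`, the probability that SOME inner-layer site is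
  surrounded by the cluster-form four-arm event from radius `r` to radius `R` is at most
  `6 ((s+1)/D + 1) · C ((r+D+1)/(R-D))^{1+ε}` — position entropy `s/D` against the four-arm cost, the `k = 1` layer of
  the summation.  (I4T) is NOT proved here (it is reduced to the named fact `SmirnovWerner2001_fourArm_scalingLimit` in
  `…NeckFourArmBoundT`); this module is unconditional in the sense that (I4T) enters as an explicit hypothesis.
-/

noncomputable section

namespace Summit.CriticalPhenomena.CardyFormulaZ2.Cruxes.NestingRigidity.PinchResampling

open MeasureTheory Set Literature.Probability.Percolation Literature.Probability.LatticeModels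

namespace NeckCoarse

variable {ω : SiteConfig (Site 2)}

/-! ## §1 Recentring -/

/-- An annulus around a nearby centre with shrunken radii lies inside the original annulus. -/
theorem tAnnulusSet_subset_of_near {w w' : Site 2} {d r R r' R' : ℕ} (hd : triNorm (w' - w) ≤ d)
    (hr' : r + d + 1 ≤ r') (hR' : R' + d ≤ R) :
    {y : Site 2 | (r' : ℤ) ≤ triNorm (y - w') ∧ triNorm (y - w') ≤ R'} ⊆
      {y | (r : ℤ) ≤ triNorm (y - w) ∧ triNorm (y - w) ≤ R} := by
  rintro z ⟨hz1, hz2⟩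
  have h1 := triNorm_sub_le_triNorm_sub_add z w' w
  have h2 := triNorm_sub_le_triNorm_sub_add z w w'
  have h3 : triNorm (w - w') = triNorm (w' - w) := by rw [← triNorm_neg, neg_sub]
  constructor <;> omega

/-- **Crossing extraction.**  A `𝕋`-path inside `S` from a site at distance `< r'` from `z` to a site at distance
`≥ R' ≥ r'` from `z` contains a segment inside `S ∩ {r' ≤ |· - z| ≤ R'}` from distance exactly `r'` to distance exactly
`R'` (for `r' = R'` the segment is the first site of the path at distance `r'`). -/
theorem exists_crossing_of_pathIn {S : Set (Site 2)} {a b z : Site 2} {r' R' : ℕ} (hp : PathIn triGraph S a b)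
    (ha : triNorm (a - z) < r') (hb : (R' : ℤ) ≤ triNorm (b - z)) (hrR' : r' ≤ R') :
    ∃ x y, triNorm (x - z) = r' ∧ triNorm (y - z) = R' ∧
      PathIn triGraph (S ∩ {w | (r' : ℤ) ≤ triNorm (w - z) ∧ triNorm (w - z) ≤ R'}) x y := by
  rcases hrR'.lt_or_eq with hlt | heq
  · exact hp.exists_annulus_arm ha.le hb hlt
  · subst heq
    obtain ⟨c, e, hc, he, heS, hce, -⟩ := hp.exit (R := {w | triNorm (w - z) < r'}) ha (by
      simp only [mem_setOf_eq, not_lt]; exact hb)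
    simp only [mem_setOf_eq, not_lt] at hc he
    have hlip := triNorm_le_triNorm_add_one_of_adj (triGraph_adj_sub hce z)
    have her : triNorm (e - z) = r' := by omega
    exact ⟨e, e, her, her, PathIn.refl ⟨heS, her.ge, her.le⟩⟩

/-- **Recentring the cluster-form four-arm event**: four arms across `{r ≤ |· - w| ≤ R}` give four arms across every
annulus `{r' ≤ |· - w'| ≤ R'}` with `|w' - w|_𝕋 ≤ d`, `r + d + 1 ≤ r' ≤ R'`, `R' + d ≤ R`: the two open crossings are cut
down to the small annulus inside their tight supports, and a junction of the two pieces inside the small annulus would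
join the original crossings inside the big one. -/
theorem tFourArmTwoClusters_of_near {w w' : Site 2} {d r R r' R' : ℕ} (hd : triNorm (w' - w) ≤ d)
    (hr' : r + d + 1 ≤ r') (hrR' : r' ≤ R') (hR' : R' + d ≤ R) (h : ω ∈ TFourArmTwoClusters w r R) :
    ω ∈ TFourArmTwoClusters w' r' R' := by
  obtain ⟨p₁, q₁, p₂, q₂, hp₁, hq₁, hp₂, hq₂, hP₁, hP₂, hsep⟩ := h
  set A : Set (Site 2) := {y | (r : ℤ) ≤ triNorm (y - w) ∧ triNorm (y - w) ≤ R} with hA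
  set A' : Set (Site 2) := {y | (r' : ℤ) ≤ triNorm (y - w') ∧ triNorm (y - w') ≤ R'} with hA'
  have hsub : A' ⊆ A := tAnnulusSet_subset_of_near hd hr' hR'
  have hne : ∀ {p q : Site 2}, triNorm (p - w) = r → triNorm (q - w) = R → p ≠ q := by
    rintro p q hp hq rfl; omega
  have hp₁ω : p₁ ∈ ω := by
    rw [tColourGraph_true] at hP₁; exact NeckCoarse.mem_of_pathIn_ne hP₁ (hne hp₁ hq₁)
  have hp₂ω : p₂ ∈ ω := by
    rw [tColourGraph_true] at hP₂; exact NeckCoarse.mem_of_pathIn_ne hP₂ (hne hp₂ hq₂)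
  obtain ⟨S₁, hS₁, hB₁, hS₁t⟩ := (NeckCoarse.pathIn_inter_of_pathIn_open hP₁ hp₁ω).exists_support
  obtain ⟨S₂, hS₂, hB₂, hS₂t⟩ := (NeckCoarse.pathIn_inter_of_pathIn_open hP₂ hp₂ω).exists_support
  have hww : triNorm (w - w') = triNorm (w' - w) := by rw [← triNorm_neg, neg_sub]
  have hstart : ∀ {p : Site 2}, triNorm (p - w) = r → triNorm (p - w') < r' := fun {p} hp ↦ by
    have := triNorm_sub_le_triNorm_sub_add p w w'; omega
  have hend : ∀ {q : Site 2}, triNorm (q - w) = R → (R' : ℤ) ≤ triNorm (q - w') := fun {q} hq ↦ by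
    have := triNorm_sub_le_triNorm_sub_add q w' w; omega
  obtain ⟨x₁, y₁, hx₁, hy₁, hc₁⟩ := exists_crossing_of_pathIn hB₁ (hstart hp₁) (hend hq₁) hrR'
  obtain ⟨x₂, y₂, hx₂, hy₂, hc₂⟩ := exists_crossing_of_pathIn hB₂ (hstart hp₂) (hend hq₂) hrR'
  have hin : ∀ {S : Set (Site 2)}, S ⊆ A ∩ ω → S ∩ A' ⊆ A' ∩ ω := fun hS z hz ↦ ⟨hz.2, (hS hz.1).2⟩
  refine ⟨x₁, y₁, x₂, y₂, hx₁, hy₁, hx₂, hy₂, NeckCoarse.pathIn_open_of_pathIn_inter (hc₁.mono (hin hS₁)),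
    NeckCoarse.pathIn_open_of_pathIn_inter (hc₂.mono (hin hS₂)), fun h12 ↦ hsep ?_⟩
  have hx₁ω : x₁ ∈ ω := (hS₁ hc₁.left_mem.1).2
  have h12' : PathIn triGraph (A ∩ ω) x₁ x₂ :=
    (NeckCoarse.pathIn_inter_of_pathIn_open h12 hx₁ω).mono fun z hz ↦ ⟨hsub hz.1, hz.2⟩
  have j₁ : PathIn triGraph (A ∩ ω) p₁ x₁ := (hS₁t x₁ hc₁.left_mem.1).mono hS₁
  have j₂ : PathIn triGraph (A ∩ ω) p₂ x₂ := (hS₂t x₂ hc₂.left_mem.1).mono hS₂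
  exact NeckCoarse.pathIn_open_of_pathIn_inter ((j₁.trans h12').trans j₂.symm)

/-! ## §2 Nets on the inner layer -/

/-- Sites of the inner layer of the collar `Λ_{2s}(x) ∖ Λ_s(x)` are at `𝕋`-distance exactly `s + 1` from `x`. -/
theorem triNorm_eq_of_mem_innerLayer {x v : Site 2} {s : ℕ}
    (hv : v ∈ innerLayer triGraph (tBall x s) (tBall x (2 * s))) : triNorm (v - x) = (s + 1 : ℕ) := by
  have h1 := triNorm_le_of_mem_innerLayer hv
  have h2 : ¬ triNorm (v - x) ≤ s := hv.1.2
  push_cast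
  omega

/-- Two points of the right side `(K, y)`, `(K, y')` of the hexagon `∂Λ_K` are at `𝕋`-distance `|y - y'|`. -/
theorem triNorm_side0_sub (K y y' : ℤ) : triNorm ((![K, y] : Site 2) - ![K, y']) = |y - y'| := by
  rw [triNorm_eq_max]
  simp only [Pi.sub_apply, Matrix.cons_val_zero, Matrix.cons_val_one, sub_self, zero_add]
  exact max_eq_right (le_max_of_le_left (abs_nonneg _)) |>.trans (max_self _)

/-- **A `D`-net of the inner layer**: for `s ≥ 0` and `D ≥ 1` there are at most `6 ((s+1)/D + 1)` sites of the hexagon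
`|· - x|_𝕋 = s + 1` such that every inner-layer site of `Λ_{2s}(x) ∖ Λ_s(x)` is within `𝕋`-distance `< D` of one of them
(sample each of the six sides `x + ρ^i (s+1, y)`, `-(s+1) ≤ y < 0`, at the multiples of `D`). -/
theorem exists_net_innerLayer (x : Site 2) (s : ℕ) {D : ℕ} (hD : 1 ≤ D) :
    ∃ T : Finset (Site 2), T.card ≤ 6 * ((s + 1) / D + 1) ∧ (∀ u ∈ T, triNorm (u - x) = (s + 1 : ℕ)) ∧
      ∀ v ∈ innerLayer triGraph (tBall x s) (tBall x (2 * s)), ∃ u ∈ T, triNorm (v - u) < D := by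
  classical
  set K : ℕ := s + 1 with hK
  set f : ℕ × ℕ → Site 2 := fun p ↦ x + triRotIsoPow p.1 ![(K : ℤ), -((D * p.2 : ℕ) : ℤ)] with hf
  refine ⟨((Finset.range 6) ×ˢ (Finset.range (K / D + 1))).image f, ?_, ?_, ?_⟩
  · refine Finset.card_image_le.trans ?_
    rw [Finset.card_product, Finset.card_range, Finset.card_range]
  · intro u hu
    obtain ⟨⟨i, k⟩, hik, rfl⟩ := Finset.mem_image.1 hu
    obtain ⟨-, hk⟩ := Finset.mem_product.1 hik
    rw [Finset.mem_range] at hk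
    have hkK : D * k ≤ K := by
      have h1 : k ≤ K / D := by omega
      calc D * k ≤ D * (K / D) := Nat.mul_le_mul_left D h1
        _ ≤ K := Nat.mul_div_le K D
    simp only [hf, add_sub_cancel_left, triNorm_rot]
    exact triNorm_side0 (by push_cast; omega) (by push_cast; omega)
  · intro v hv
    have hvK : triNorm (v - x) = K := triNorm_eq_of_mem_innerLayer hv
    obtain ⟨i, hi, y, hy1, hy2, hvx⟩ := exists_rot_side0 (N := K) (by omega) hvK
    -- the sample index `k = ⌊-y / D⌋`
    set k : ℕ := (-y).toNat / D with hk
    have hy0 : ((-y).toNat : ℤ) = -y := Int.toNat_of_nonneg (by omega)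
    have hdm := Nat.div_add_mod (-y).toNat D
    have hml := Nat.mod_lt (-y).toNat (by omega : D > 0)
    have hkK : k < K / D + 1 := by
      have : (-y).toNat ≤ K := by omega
      have := Nat.div_le_div_right (c := D) this
      omega
    refine ⟨f (i, k), Finset.mem_image_of_mem f (Finset.mem_product.2 ⟨Finset.mem_range.2 hi, Finset.mem_range.2 hkK⟩), ?_⟩
    have hvsub : v - f (i, k) = triRotIsoPow i (![(K : ℤ), y] - ![(K : ℤ), -((D * k : ℕ) : ℤ)]) := by
      rw [triRotIsoPow_map_sub, ← hvx, hf]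
      simp only
      abel
    have hA : ((D * k : ℕ) : ℤ) ≤ -y := by
      have h1 : D * k ≤ (-y).toNat := by rw [hk]; exact Nat.mul_div_le _ _
      have h2 : ((D * k : ℕ) : ℤ) ≤ ((-y).toNat : ℤ) := by exact_mod_cast h1
      omega
    have hB : -y < ((D * k + D : ℕ) : ℤ) := by
      have h1 : (-y).toNat < D * k + D := by
        rw [hk]
        have := Nat.lt_div_mul_add (a := (-y).toNat) (b := D) (by omega)
        linarith [Nat.div_add_mod (-y).toNat D, mul_comm D ((-y).toNat / D)]
      have h2 : ((-y).toNat : ℤ) < ((D * k + D : ℕ) : ℤ) := by exact_mod_cast h1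
      omega
    rw [hvsub, triNorm_rot, triNorm_side0_sub, abs_lt]
    push_cast at hA hB ⊢
    constructor <;> linarith

end NeckCoarse

/-! ## §3 The union bound over the inner layer (`k = 1` layer of the summation) -/

/-- **Four arms around SOME inner-layer site: position entropy against the four-arm cost (registered helper, anchor of
this module on the crux item).**  GIVEN the two-radius four-arm bound (I4T) `FourArmTwoClustersBoundT`, there are `C`
and `ε > 0` such that for all centres `x`, radii `s`, resolutions `D ≥ 1` and radii `1 ≤ r`,
`r + D + 1 ≤ R - D`, the probability that some inner-layer site of the collar `Λ_{2s}(x) ∖ Λ_s(x)` is surrounded by the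
cluster-form four-arm event from radius `r` to radius `R` is at most `6 ((s+1)/D + 1) · C ((r + D + 1) / (R - D))^{1+ε}`
(recentre to the `D`-net of the inner layer, union bound, four-arm bound at every net point). -/
theorem real_exists_tFourArm_innerLayer_le : FourArmTwoClustersBoundT → ∃ C ε : ℝ, 0 < ε ∧ ∀ (x : Site 2) (s D r R : ℕ), 1 ≤ D → 1 ≤ r → r + D + 1 ≤ R - D → (triSitePercolation half).real {ω | ∃ v ∈ innerLayer triGraph (tBall x s) (tBall x (2 * s)), ω ∈ TFourArmTwoClusters v r R} ≤ 6 * (((s + 1) / D + 1 : ℕ) : ℝ) * (C * (((r + D + 1 : ℕ) : ℝ) / ((R - D : ℕ) : ℝ)) ^ (1 + ε)) := by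
  rintro ⟨ε, C, hε, h4⟩
  refine ⟨C, ε, hε, fun x s D r R hD hr hrR ↦ ?_⟩
  set μ := triSitePercolation half with hμ
  set r' := r + D + 1 with hr'
  set R' := R - D with hR'
  have hr'1 : 1 ≤ r' := by omega
  obtain ⟨T, hTcard, -, hTnet⟩ := NeckCoarse.exists_net_innerLayer x s hD
  -- recentre to the net
  have hcover : {ω | ∃ v ∈ innerLayer triGraph (tBall x s) (tBall x (2 * s)), ω ∈ TFourArmTwoClusters v r R} ⊆
      ⋃ u ∈ T, TFourArmTwoClusters u r' R' := by
    rintro ω ⟨v, hv, hω⟩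
    obtain ⟨u, hu, hvu⟩ := hTnet v hv
    have hd : triNorm (u - v) ≤ D := by rw [← triNorm_neg, neg_sub]; exact hvu.le
    exact mem_biUnion hu (NeckCoarse.tFourArmTwoClusters_of_near hd le_rfl (by omega) (by omega) hω)
  have hnn : 0 ≤ C * (((r + D + 1 : ℕ) : ℝ) / ((R - D : ℕ) : ℝ)) ^ (1 + ε) :=
    measureReal_nonneg.trans (h4 x r' R' hr'1 (by omega))
  calc μ.real {ω | ∃ v ∈ innerLayer triGraph (tBall x s) (tBall x (2 * s)), ω ∈ TFourArmTwoClusters v r R}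
      ≤ μ.real (⋃ u ∈ T, TFourArmTwoClusters u r' R') := measureReal_mono hcover (measure_ne_top _ _)
    _ ≤ ∑ u ∈ T, μ.real (TFourArmTwoClusters u r' R') := measureReal_biUnion_finset_le _ _
    _ ≤ ∑ _u ∈ T, C * ((r' : ℝ) / R') ^ (1 + ε) := Finset.sum_le_sum fun u _ ↦ h4 u r' R' hr'1 (by omega)
    _ = T.card * (C * ((r' : ℝ) / R') ^ (1 + ε)) := by rw [Finset.sum_const, nsmul_eq_mul]
    _ ≤ 6 * (((s + 1) / D + 1 : ℕ) : ℝ) * (C * (((r + D + 1 : ℕ) : ℝ) / ((R - D : ℕ) : ℝ)) ^ (1 + ε)) := by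
        have hcard : (T.card : ℝ) ≤ 6 * (((s + 1) / D + 1 : ℕ) : ℝ) := by exact_mod_cast hTcard
        simpa [hr', hR'] using mul_le_mul_of_nonneg_right hcard hnn

end Summit.CriticalPhenomena.CardyFormulaZ2.Cruxes.NestingRigidity.PinchResampling

end
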